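import Summits.BirchSwinnertonDyer.BirchSwinnertonDyer.Theses.ShaPrimaryTransfer
import Literature.Barriers.BirchSwinnertonDyer.AnomalousHeegnerLogWall
import Literature.NumberTheory.EllipticCurves.Rank1Residual.GVParityTwistProofs
import Literature.NumberTheory.EllipticCurves.MazurTorsionGaloisStructureProofs
import Literature.NumberTheory.EllipticCurves.KubertTateM919GaussianTwist
import Literature.NumberTheory.EllipticCurves.IwasawaLeadingTermProofs
import HarnessLib

/-!
# BirchSwinnertonDyer / ShaPrimaryTransfer — crux `FiniteShaComponentTransfer` (stmt-BirchSwinnertonDyer-22356):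
# the rank-1 door `E_{-91/9}^{(-4)}` at `5` is an ANOMALOUS Eisenstein pair — behind the printed-scope wall

Helper file of prover seat `bsd-line-spt-p1` g21 (`--supports stmt-22356 --as helper`). THEOREMS ONLY, pure placement. The
tree proves unconditionally (`KubertTateM919GaussianTwist.twist_M91_9`) that `W = E_{-91/9}^{(-4)} = [0, −13276, 0, 5896800, −869306256]`
has `rank W(ℚ) = 1` and `t₅(W) = 0`, i.e. `corank_{ℤ₅} Sel_{5^∞}(W/ℚ) = 1` — the hypothesis of a `5`-CONVERSE theorem, whose conclusion
(`ord_{s=1} L(W, s) = 1`, then GZK) would give `Ш(W/ℚ)` finite and hence T's instance at `W` outright.  This file records WHY NO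
REFEREED `5`-converse applies: the pair `(W, 5)` is an anomalous Eisenstein pair of good reduction —

* `red_five`, `red_five_twist` — `E_{-91/9}[5]` is reducible (rational point of order `5`), hence so is `W[5]` (quadratic twist);
* `anom_five_twist` — **`Rank1Residual.Anom W 5`**: reducible, good at `5`, `a₅(W) = 1 ≡ 1 (mod 5)` (the isogeny character `χ₋₄` is
  trivial on `G_5` since `5` splits in `ℚ(i)`);
* `not_printedScope_five_twist` — by the tree's barrier `AnomalousHeegnerLogWall`, `(W, 5)` lies OUTSIDE the printed scope
  `PrintedEisensteinHeegnerLogScope` of every refereed Heegner-log / BDP-value / Eisenstein `p`-converse theorem (CGLS 2022 Thm. E and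
  CGS 2025 Thm. A assume `φ|_{G_p} ≠ 𝟙, ω`; BST-W 2024 / Kim 2022 assume `E[p]` irreducible).  The only printed claim covering it is
  Keller–Yin arXiv:2402.12781 Thm. 4.1.1 (preprint; not a tree fact).
* `transfer_twist_of_shaFinite` — what remains: T at `W` is EXACTLY «`Ш(W/ℚ)[q^∞]` has corank `0` for every `q`», which any
  `5`-converse at this anomalous pair (or a direct computation of `L'(W,1) ≠ 0` + GZK) would supply.

The same holds for every Gaussian-twist row of the instrument (`a₅(E_{m,n}^{(-4)}) = a₅(E_{m,n}) ≡ 1 (mod 5)`); the refereed escape is a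
twist by `D` with `(D/5) = −1` (then `a₅ ≡ −1`, CGLS Thm. E applies) — a descent over `ℚ(√D)` not yet in the tree.  T is UNCHANGED
(conjecture-grade at corank ≥ 2) and BSD is NOT proved by any of this.

## References

* [SilvermanAEC2009] J. H. Silverman, *AEC*, 2nd ed., VII.3, X.5 Cor. 5.4.
* [Mazur1977] B. Mazur, *Modular curves and the Eisenstein ideal*, Ch. III §5.
* [CastellaGrossiLeeSkinner2022] F. Castella, G. Grossi, J. Lee, C. Skinner, Invent. Math. 227 (2022), Thm. E (hypothesis `φ|G_p ≠ 1, ω`).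
* [KrizLi2019] D. Kriz, C. Li, Thm. 1.12 (first bullet).
-/

-- D-0017: single-problem summit, so `Summit.BirchSwinnertonDyer.BirchSwinnertonDyer.…` repeats a namespace BY DESIGN.
set_option linter.dupNamespace false
set_option autoImplicit false

noncomputable section

open scoped Classical
open Literature.NumberTheory.EllipticCurves WeierstrassCurve
open Literature.NumberTheory.EllipticCurves.Rank1Residual
open Literature.Barriers.BirchSwinnertonDyer
open Summit.BirchSwinnertonDyer.BirchSwinnertonDyer.Theses.ShaPrimaryTransfer

namespace Summit.BirchSwinnertonDyer.BirchSwinnertonDyer.Theorems.ShaPrimaryTransferGaussianTwistDoorM919Anomalous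

/-- **`E_{-91/9}[5]` is reducible**: the curve carries a rational point of order `5` (the Kubert–Tate marked point `(0,0)`), whose
line is `Γ_ℚ`-stable. [cite: Mazur1977, Ch. III §5, p. 157] -/
theorem red_five :
    haveI : Fact (Nat.Prime 5) := ⟨Nat.prime_five⟩
    ¬ (kubertTateFive (((-91 : ℤ) : ℚ)) (((9 : ℤ) : ℚ))).HasIrreducibleModPGaloisRep 5 := by
  haveI := KubertTateM919Descent.isElliptic
  haveI : Fact (Nat.Prime 5) := ⟨Nat.prime_five⟩
  obtain ⟨P, hP⟩ := exists_addOrderOf_eq_five_kubertTateFive (F := ℚ) (m := (((-91 : ℤ) : ℚ))) (n := (((9 : ℤ) : ℚ)))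
    (by norm_num) (by norm_num)
  exact not_hasIrreducibleModPGaloisRep_of_addOrderOf_eq _ hP

/-- **`E_{-91/9}^{(-4)}[5]` is reducible** (a quadratic twist of a curve with reducible `E[5]`; the twist isomorphism moves a rational
line to a rational line). [cite: SilvermanAEC2009, X.5 Cor. 5.4] -/
theorem red_five_twist :
    haveI : Fact (Nat.Prime 5) := ⟨Nat.prime_five⟩
    ¬ ((kubertTateFive (((-91 : ℤ) : ℚ)) (((9 : ℤ) : ℚ))).quadraticTwist (-4)).HasIrreducibleModPGaloisRep 5 := by
  haveI := KubertTateM919Descent.isElliptic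
  haveI := KubertTateM919GaussianTwist.isElliptic_twist
  haveI : Fact (Nat.Prime 5) := ⟨Nat.prime_five⟩
  exact not_hasIrreducibleModPGaloisRep_twist red_five (d := -4) (by norm_num) _ 1 (one_smul _ _)

/-- **`(E_{-91/9}^{(-4)}, 5)` is an anomalous Eisenstein pair**: `W[5]` reducible, good reduction at `5`, and `a₅(W) = 1 ≡ 1 (mod 5)`
(tree `KubertTateM919GaussianTwist.goodOrdinary_five_twist`). [cite: KrizLi2019, Thm. 1.12 (first bullet)] [cite: SilvermanAEC2009, VII.3.1(b)] -/
theorem anom_five_twist :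
    haveI := KubertTateM919GaussianTwist.isGloballyMinimal_twist
    haveI : Fact (Nat.Prime 5) := ⟨Nat.prime_five⟩
    Anom ((kubertTateFive (((-91 : ℤ) : ℚ)) (((9 : ℤ) : ℚ))).quadraticTwist (-4)) 5 := by
  haveI := KubertTateM919GaussianTwist.isGloballyMinimal_twist
  haveI : Fact (Nat.Prime 5) := ⟨Nat.prime_five⟩
  obtain ⟨ha, hgood⟩ := KubertTateM919GaussianTwist.goodOrdinary_five_twist
  exact ⟨red_five_twist, hgood, by rw [ha]; norm_num⟩

/-- **The rank-1 door `(E_{-91/9}^{(-4)}, 5)` is outside the printed scope of every refereed Eisenstein Heegner-log / `p`-converse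
theorem** (tree barrier `AnomalousHeegnerLogWall`: the printed standing hypothesis is `a_p ≢ 1 (mod p)`).
[cite: CastellaGrossiLeeSkinner2022, Thm. E (hypothesis φ|G_p ≠ 1, ω)] [cite: KrizLi2019, Thm. 1.12 (first bullet)] -/
theorem not_printedScope_five_twist :
    haveI := KubertTateM919GaussianTwist.isGloballyMinimal_twist
    haveI : Fact (Nat.Prime 5) := ⟨Nat.prime_five⟩
    ¬ PrintedEisensteinHeegnerLogScope ((kubertTateFive (((-91 : ℤ) : ℚ)) (((9 : ℤ) : ℚ))).quadraticTwist (-4)) 5 := by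
  haveI := KubertTateM919GaussianTwist.isGloballyMinimal_twist
  haveI : Fact (Nat.Prime 5) := ⟨Nat.prime_five⟩
  exact AnomalousHeegnerLogWall.not_printedScope_of_anom anom_five_twist

/-- **What remains for T at this curve**: since `t₅(W) = 0` unconditionally, T's instance at `W = E_{-91/9}^{(-4)}` follows from (indeed is
equivalent to) «`Ш(W/ℚ)[q^∞]` has corank `0` for every prime `q`» — in particular from `Ш(W/ℚ)` finite, the output of any `5`-converse at this
anomalous pair followed by Gross–Zagier–Kolyvagin. [cite: SilvermanAEC2009, Thm. X.4.2] -/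
theorem transfer_twist_of_shaFinite
    (hfin : haveI := KubertTateM919GaussianTwist.isElliptic_twist
      Finite ((kubertTateFive (((-91 : ℤ) : ℚ)) (((9 : ℤ) : ℚ))).quadraticTwist (-4)).sha)
    (p q : ℕ) [Fact p.Prime] [Fact q.Prime] :
    haveI := KubertTateM919GaussianTwist.isElliptic_twist
    ((kubertTateFive (((-91 : ℤ) : ℚ)) (((9 : ℤ) : ℚ))).quadraticTwist (-4)).shaCorank p = 0 →
      ((kubertTateFive (((-91 : ℤ) : ℚ)) (((9 : ℤ) : ℚ))).quadraticTwist (-4)).shaCorank q = 0 := by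
  haveI := KubertTateM919GaussianTwist.isElliptic_twist
  intro _
  haveI := hfin
  exact (finite_primaryComponent_sha_iff_shaCorank_eq_zero _ q).1 inferInstance

end Summit.BirchSwinnertonDyer.BirchSwinnertonDyer.Theorems.ShaPrimaryTransferGaussianTwistDoorM919Anomalous

end
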